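import Mathlib
import HarnessLib
import Literature.Computability.AlgebraicComplexity.PowerSumNonvanishing
import Summits.ValiantsHypothesis.ValiantsHypothesis.Theorems.SummationBitsRyserOptimalDepth3StubEsymNormalForm
import Summits.ValiantsHypothesis.ValiantsHypothesis.Theses.SummationBits

/-!
# Crux `SummationBits.RyserOptimalDepth3` (stmt-ValiantsHypothesis-7565), line `registered` —
# the GRADED elementary-symmetric normal form (insurance for the heart stub)

Support file (lead prover, `--supports stmt-ValiantsHypothesis-7565`).  The landed stub N
(`stub_esymNormalForm`) keeps, of an affine depth-three expression `per_n = Σ_{i<r} Π_{j<D} ℓ_ij`,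
only the degree-`n` identity `Σ_i a_i e_n(m_i) = per_n` of its generic translate.  The heart stub
H (`stub_esymHighDegree`) is stated for such degree-`n` identities alone and is therefore slightly
STRONGER than the crux needs (an e-representation converts back to an affine expression only at
the price `r ↦ r·(D+1)`, Ben-Or interpolation).  Should H fall to a degree-`n`-only witness, the
line's recorded fallback is the GRADED e-system, which is equivalent to the crux's high-degree
regime; this file provides its normal form now, with the same `(r, D)`:

* `graded_esymNormalForm` — for an affine expression of `per_n` there are a point `u`, scalars
  `a_i` and linear forms `m_ij` such that for EVERY degree `k`,
  `Σ_i a_i · e_k(m_i1, …, m_iD) = [per_n(x + u)]_k` (degree-`k` homogeneous component of the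
  translate); at `k = n` the right-hand side is `per_n` (`graded_esymNormalForm_top`).
* `affine_of_gradedESym` — conversely, a graded e-system `(u, a, m)` with parameters `(r, D)`
  (`n ≥ 1`) gives back an affine depth-three expression of `per_n` with the SAME `(r, D)`: summing
  the identities over `k` gives `Σ_i a_i Π_j (1 + m_ij) = per_n(x + u)`, and translating by `−u`
  finishes.  Hence (`ryserOptimal_imp_gradedBound`) the crux `RyserOptimalDepth3` implies the
  graded e-system bound `2^n ≤ r (D+1) (n+2)^c` for all `D` — the graded heart is EXACTLY as strong
  as the crux's high-degree regime, unlike the degree-`n`-only heart (one factor `D+1` stronger,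
  see `Theorems/SummationBitsRyserOptimalDepth3EsymToAffine.lean`).

Everything is assembled from the landed helpers of
`Theorems/SummationBitsRyserOptimalDepth3StubEsymNormalForm.lean`
(`exists_eval_ne_zero`, `homogeneousComponent_prod_translate`,
`homogeneousComponent_translate_perPoly`).  Reference for the model: A. Shpilka, *Affine
projections of symmetric polynomials*, J. Comput. System Sci. 65 (2002).
-/

-- Sub = Summit layout; duplicated namespace component intended
set_option linter.dupNamespace false

namespace Summit.ValiantsHypothesis.ValiantsHypothesis.Theorems.SummationBitsRyserOptimalDepth3

open MvPolynomial
open Literature.Computability.AlgebraicComplexity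

namespace GradedNormalForm

/-- **Graded elementary-symmetric normal form.** An affine depth-three expression
`per_n = Σ_{i<r} Π_{j<D} ℓ_ij` yields a translation vector `u`, scalars `a_i` and
degree-1-homogeneous `m_ij` (same `r`, same `D`) with, for every `k`,
`Σ_i a_i · e_k(m_i1, …, m_iD) = [per_n(x+u)]_k`. [cite: Shpilka2002, symmetric model of depth three] -/
theorem graded_esymNormalForm {n r D : ℕ} (ℓ : Fin r → Fin D → MvPolynomial (Fin n × Fin n) ℂ)
    (hℓ : ∀ i j, (ℓ i j).totalDegree ≤ 1) (hsum : (∑ i, ∏ j, ℓ i j) = perPoly (Fin n) ℂ) :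
    ∃ (u : Fin n × Fin n → ℂ) (a : Fin r → ℂ) (m : Fin r → Fin D → MvPolynomial (Fin n × Fin n) ℂ),
      (∀ i j, (m i j).IsHomogeneous 1) ∧
        ∀ k : ℕ, (∑ i, C (a i) * aeval (m i) (esymm (Fin D) ℂ k)) =
          homogeneousComponent k (aeval (fun v => X v + C (u v)) (perPoly (Fin n) ℂ)) := by
  obtain ⟨u, hu⟩ :=
    StubEsymNormalForm.exists_eval_ne_zero (fun ij : Fin r × Fin D => ℓ ij.1 ij.2)
  refine ⟨u, fun i => ∏ j, eval u (ℓ i j),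
    fun i j => C (eval u (ℓ i j))⁻¹ * ∑ v, C (coeff (Finsupp.single v 1) (ℓ i j)) * X v,
    fun i j => (StubEsymNormalForm.isHomogeneous_linearPart (ℓ i j)).C_mul _, fun k => ?_⟩
  -- translate the given expression by `u` and take the degree-`k` homogeneous component
  have key := congrArg (fun p => homogeneousComponent k (aeval (fun v => X v + C (u v)) p)) hsum
  simp only [map_sum, map_prod] at key
  rw [← key]
  refine Finset.sum_congr rfl fun i _ => ?_
  exact (StubEsymNormalForm.homogeneousComponent_prod_translate u (ℓ i) (hℓ i)
    (fun j => hu (i, j)) k).symm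

/-- The degree-`n` member of the graded system is the landed stub N's identity:
`[per_n(x+u)]_n = per_n`. [folklore] -/
theorem graded_esymNormalForm_top {n r D : ℕ} (ℓ : Fin r → Fin D → MvPolynomial (Fin n × Fin n) ℂ)
    (hℓ : ∀ i j, (ℓ i j).totalDegree ≤ 1) (hsum : (∑ i, ∏ j, ℓ i j) = perPoly (Fin n) ℂ) :
    ∃ (u : Fin n × Fin n → ℂ) (a : Fin r → ℂ) (m : Fin r → Fin D → MvPolynomial (Fin n × Fin n) ℂ),
      (∀ i j, (m i j).IsHomogeneous 1) ∧
        (∀ k : ℕ, (∑ i, C (a i) * aeval (m i) (esymm (Fin D) ℂ k)) =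
          homogeneousComponent k (aeval (fun v => X v + C (u v)) (perPoly (Fin n) ℂ))) ∧
        (∑ i, C (a i) * aeval (m i) (esymm (Fin D) ℂ n)) = perPoly (Fin n) ℂ := by
  obtain ⟨u, a, m, hm, hk⟩ := graded_esymNormalForm ℓ hℓ hsum
  refine ⟨u, a, m, hm, hk, ?_⟩
  rw [hk n, StubEsymNormalForm.homogeneousComponent_translate_perPoly]

/-- The graded identities the degree-`n` statement forgets, made explicit: for `k > n` the
right-hand side vanishes (`per_n(x+u)` has total degree `≤ n`), so `Σ_i a_i e_k(m_i) = 0` for all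
`k > n`. [folklore] -/
theorem graded_esymNormalForm_vanish {n r D : ℕ} (ℓ : Fin r → Fin D → MvPolynomial (Fin n × Fin n) ℂ)
    (hℓ : ∀ i j, (ℓ i j).totalDegree ≤ 1) (hsum : (∑ i, ∏ j, ℓ i j) = perPoly (Fin n) ℂ) :
    ∃ (u : Fin n × Fin n → ℂ) (a : Fin r → ℂ) (m : Fin r → Fin D → MvPolynomial (Fin n × Fin n) ℂ),
      (∀ i j, (m i j).IsHomogeneous 1) ∧
        (∀ k : ℕ, (∑ i, C (a i) * aeval (m i) (esymm (Fin D) ℂ k)) =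
          homogeneousComponent k (aeval (fun v => X v + C (u v)) (perPoly (Fin n) ℂ))) ∧
        ∀ k : ℕ, n < k → (∑ i, C (a i) * aeval (m i) (esymm (Fin D) ℂ k)) = 0 := by
  obtain ⟨u, a, m, hm, hk⟩ := graded_esymNormalForm ℓ hℓ hsum
  refine ⟨u, a, m, hm, hk, fun k hnk => ?_⟩
  rw [hk k]
  apply homogeneousComponent_eq_zero
  refine lt_of_le_of_lt ?_ hnk
  -- `deg per_n(x+u) ≤ deg per_n ≤ n`
  refine (totalDegree_aeval_le_of_forall_le_one _ (fun v => ?_) _).trans ?_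
  · exact (totalDegree_add _ _).trans (max_le (totalDegree_X (R := ℂ) v).le (by simp))
  · simpa using (perPoly_isHomogeneous (n := Fin n) (k := ℂ)).totalDegree_le

/-- `Π_j (1 + m_j) = Σ_{k ≤ D} e_k(m_1, …, m_D)` (grouping the subsets of `Fin D` by size).
[folklore] -/
theorem prod_one_add_eq_sum_aeval_esymm {σ : Type*} {D : ℕ} (m : Fin D → MvPolynomial σ ℂ) :
    (∏ j, (1 + m j)) = ∑ k ∈ Finset.range (D + 1), aeval m (esymm (Fin D) ℂ k) := by
  classical
  rw [Finset.prod_one_add, Finset.powerset_card_disjiUnion, Finset.sum_disjiUnion,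
    Finset.card_univ, Fintype.card_fin]
  refine Finset.sum_congr rfl fun k _ => ?_
  simp only [esymm, map_sum, map_prod, aeval_X]

/-- All homogeneous components up to any bound `M ≥ deg φ` sum to `φ`. [folklore] -/
theorem sum_range_homogeneousComponent {σ : Type*} (φ : MvPolynomial σ ℂ) {M : ℕ}
    (hM : φ.totalDegree ≤ M) :
    (∑ k ∈ Finset.range (M + 1), homogeneousComponent k φ) = φ := by
  have hsplit := Finset.sum_range_add_sum_Ico (fun k => homogeneousComponent k φ)
    (Nat.succ_le_succ hM)
  rw [← hsplit, sum_homogeneousComponent, Finset.sum_eq_zero (fun k hk => ?_), add_zero]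
  exact homogeneousComponent_eq_zero _ _ (Nat.lt_of_succ_le (Finset.mem_Ico.1 hk).1)

/-- **From a graded e-system back to affine depth three, same `(r, D)`.**  If
`Σ_i a_i · e_k(m_i1, …, m_iD) = [per_n(x+u)]_k` for every `k` (`m_ij` linear, `n ≥ 1`), then
`per_n = Σ_{i<r} Π_{j<D} ℓ_ij` for affine `ℓ_ij` — namely `ℓ_ij = 1 + m_ij(x − u)`, with the scalar
`a_i` folded into one factor. [folklore] -/
theorem affine_of_gradedESym {n r D : ℕ} (hn : 1 ≤ n) (u : Fin n × Fin n → ℂ) (a : Fin r → ℂ)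
    (m : Fin r → Fin D → MvPolynomial (Fin n × Fin n) ℂ) (hm : ∀ i j, (m i j).IsHomogeneous 1)
    (hk : ∀ k : ℕ, (∑ i, C (a i) * aeval (m i) (esymm (Fin D) ℂ k)) =
      homogeneousComponent k (aeval (fun v => X v + C (u v)) (perPoly (Fin n) ℂ))) :
    ∃ ℓ : Fin r → Fin D → MvPolynomial (Fin n × Fin n) ℂ,
      (∀ i j, (ℓ i j).totalDegree ≤ 1) ∧ (∑ i, ∏ j, ℓ i j) = perPoly (Fin n) ℂ := by
  classical
  -- the translate `per_n(x+u)` and its degree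
  set P := aeval (fun v => X v + C (u v)) (perPoly (Fin n) ℂ) with hP
  have hdegP : P.totalDegree ≤ n := by
    refine (totalDegree_aeval_le_of_forall_le_one _ (fun v => ?_) _).trans ?_
    · exact (totalDegree_add _ _).trans (max_le (totalDegree_X (R := ℂ) v).le (by simp))
    · simpa using (perPoly_isHomogeneous (n := Fin n) (k := ℂ)).totalDegree_le
  -- `D ≥ n`, for otherwise the degree-`n` identity reads `0 = per_n`
  have hnD : n ≤ D := by
    by_contra hlt
    push Not at hlt
    have h0 : esymm (Fin D) ℂ n = 0 := by
      rw [esymm, Finset.powersetCard_eq_empty.2 (by simpa using hlt), Finset.sum_empty]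
    have := hk n
    rw [h0] at this
    simp only [map_zero, mul_zero, Finset.sum_const_zero] at this
    rw [StubEsymNormalForm.homogeneousComponent_translate_perPoly] at this
    exact perPoly_ne_zero (Fin n) ℂ this.symm
  -- sum the graded identities over `k ≤ D`: `Σ_i a_i Π_j (1 + m_ij) = per_n(x+u)`
  have hall : (∑ i, C (a i) * ∏ j, (1 + m i j)) = P := by
    calc (∑ i, C (a i) * ∏ j, (1 + m i j))
          = ∑ i, ∑ k ∈ Finset.range (D + 1), C (a i) * aeval (m i) (esymm (Fin D) ℂ k) := by
            refine Finset.sum_congr rfl fun i _ => ?_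
            rw [prod_one_add_eq_sum_aeval_esymm, Finset.mul_sum]
      _ = ∑ k ∈ Finset.range (D + 1), homogeneousComponent k P := by
            rw [Finset.sum_comm]
            exact Finset.sum_congr rfl fun k _ => hk k
      _ = P := sum_range_homogeneousComponent P (hdegP.trans hnD)
  -- translate back by `-u`
  set T := aeval (R := ℂ) (fun v : Fin n × Fin n => (X v - C (u v) : MvPolynomial (Fin n × Fin n) ℂ))
    with hT
  have hTP : T P = perPoly (Fin n) ℂ := by
    rw [hP, hT, comp_aeval_apply]
    have : (fun v : Fin n × Fin n => aeval (R := ℂ)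
        (fun v : Fin n × Fin n => (X v - C (u v) : MvPolynomial (Fin n × Fin n) ℂ))
        (X v + C (u v))) = X := by
      funext v
      simp
    rw [this, aeval_X_left_apply]
  have hTaff : ∀ i j, (T (m i j)).totalDegree ≤ 1 := fun i j => by
    refine (totalDegree_aeval_le_of_forall_le_one _ (fun v => ?_) _).trans (hm i j).totalDegree_le
    exact (totalDegree_sub _ _).trans (max_le (totalDegree_X (R := ℂ) v).le (by simp))
  -- a slot for the scalar
  have j₀ : Fin D := ⟨0, by omega⟩
  refine ⟨fun i j => (if j = j₀ then C (a i) else 1) * (1 + T (m i j)), fun i j => ?_, ?_⟩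
  · refine (totalDegree_mul _ _).trans ?_
    have h1 : (if j = j₀ then C (a i) else (1 : MvPolynomial (Fin n × Fin n) ℂ)).totalDegree = 0 := by
      split_ifs
      · exact totalDegree_C _
      · exact totalDegree_one
    have h2 : (1 + T (m i j)).totalDegree ≤ 1 :=
      (totalDegree_add _ _).trans (max_le (by simp) (hTaff i j))
    omega
  · have hprod : ∀ i : Fin r, (∏ j, (if j = j₀ then C (a i) else 1) * (1 + T (m i j))) =
        C (a i) * ∏ j, (1 + T (m i j)) := by
      intro i
      rw [Finset.prod_mul_distrib, Finset.prod_ite_eq']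
      simp
    simp_rw [hprod]
    have key := congrArg T hall
    rw [hTP, map_sum] at key
    rw [← key]
    refine Finset.sum_congr rfl fun i _ => ?_
    rw [map_mul, map_prod]
    have hC : T (C (a i)) = C (a i) := by rw [hT, aeval_C, algebraMap_eq]
    simp only [map_add, map_one, hC]

end GradedNormalForm

/-- **Registered sub-goal `stub_gradedToAffine` of crux stmt-ValiantsHypothesis-7565** (lead, line
`registered`): a graded e-system for `per_n` with parameters `(r, D)` gives back an affine
depth-three expression with the same `(r, D)` — `GradedNormalForm.affine_of_gradedESym` under its
registered name (so a GRADED heart is crux-equivalent in its regime). [folklore] -/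
theorem stub_gradedToAffine :
    ∀ n r D : ℕ, 1 ≤ n →
      ∀ (u : Fin n × Fin n → ℂ) (a : Fin r → ℂ) (m : Fin r → Fin D → MvPolynomial (Fin n × Fin n) ℂ),
        (∀ i j, (m i j).IsHomogeneous 1) →
          (∀ k : ℕ, (∑ i, C (a i) * aeval (m i) (esymm (Fin D) ℂ k)) =
            homogeneousComponent k (aeval (fun v => X v + C (u v)) (perPoly (Fin n) ℂ))) →
            ∃ ℓ : Fin r → Fin D → MvPolynomial (Fin n × Fin n) ℂ,
              (∀ i j, (ℓ i j).totalDegree ≤ 1) ∧ (∑ i, ∏ j, ℓ i j) = perPoly (Fin n) ℂ :=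
  fun _n _r _D hn u a m hm hk => GradedNormalForm.affine_of_gradedESym hn u a m hm hk

/-- **The crux implies the graded e-system bound, same charge.**  If Ryser is optimal at depth
three up to `poly(n)` (`SummationBits.RyserOptimalDepth3`), then every graded e-system for `per_n`
(`Σ_i a_i e_k(m_i) = [per_n(x+u)]_k` for all `k`, `m_ij` linear) has `2^n ≤ r (D+1) (n+2)^c` — so a
GRADED heart is exactly as strong as the crux's high-degree regime
(`GradedNormalForm.affine_of_gradedESym`). [folklore] -/
theorem ryserOptimal_imp_gradedBound
    (h : Summit.ValiantsHypothesis.ValiantsHypothesis.Theses.SummationBits.RyserOptimalDepth3) :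
    ∃ c : ℕ, ∀ n : ℕ, 1 ≤ n →
      ∀ (r D : ℕ) (u : Fin n × Fin n → ℂ) (a : Fin r → ℂ)
        (m : Fin r → Fin D → MvPolynomial (Fin n × Fin n) ℂ),
        (∀ i j, (m i j).IsHomogeneous 1) →
          (∀ k : ℕ, (∑ i, C (a i) * aeval (m i) (esymm (Fin D) ℂ k)) =
            homogeneousComponent k (aeval (fun v => X v + C (u v)) (perPoly (Fin n) ℂ))) →
            2 ^ n ≤ r * (D + 1) * (n + 2) ^ c := by
  obtain ⟨c, hc⟩ := h
  refine ⟨c, fun n hn r D u a m hm hk => ?_⟩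
  obtain ⟨ℓ, hℓ, hsum⟩ := GradedNormalForm.affine_of_gradedESym hn u a m hm hk
  exact hc n hn r D ℓ hℓ hsum

end Summit.ValiantsHypothesis.ValiantsHypothesis.Theorems.SummationBitsRyserOptimalDepth3
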